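/-
COR-CM (cells pub-hodgecm / pub-hodgecm2, stage 2 of the Hodge ladder) — TRANSPOSITION item (vi), S-LANE CARRIERS-PLAN steps S5 × S6 ON THE PLUGGED-R REST («BUILT-R»):
the re-cut #4 display `Transposition/Item6SupplyPinnedAssemblyAlongHoldsRestOnePluggedR.lean` (pin-2, on own-htheta's re-cut #3) with its LAST TWO POSITED CARRIERS taken BY NAME from
the tree — `C := Model.sec42DataOf h Model.isoOf` (pin-1, `HComp/Sec42DataOf.lean`, CARRIERS-PLAN S5, Albanese-free v3: Liu's §4.2 / App. C standing datum
{X_K, A_K, ∇u, Alb_u} over the HONEST Prop-C.5 datum, Deligne's canonical models from the cite `h`, Albanese data from the tree's `Albanese.nonempty_of_numberField`)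
and `T := Model.heckeTranslatesFamilyOf heckeTranslate_definedOver_holds h Model.isoOf` (TEAM hComp / hcomp-shimura, `HComp/HeckeTranslatesOfSec42DataOf.lean` over
`HComp/HeckeTranslatesOfRecord.lean` U7, CARRIERS-PLAN S6: the Hecke translates of the canonical-model record, [MilISV] Thm. 13.6 — the named fact
`heckeTranslate_definedOver` DISCHARGED in the tree by `heckeTranslate_definedOver_holds`, hcomp-shimura's U7-DECITE `ShimuraVarieties/UnitaryShimuraCanonicalModelHeckeHolds.lean` p323431) — and the composite Albanese cite `hA` DECITED
to the one-sentence form `hAb : Liu2021.albanese_baseChange` ([Liu2021] §2.1 Prop. 2.2 + [FGA VI 3.3 (iii)]) by hcomp-abcm-1's `albanese_baseChange_isLimit_fan_jacobian_of_albanese_baseChange`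
(`Liu2021/AlbaneseBaseChangeProduct.lean` p312823).  EFFECT ON THE DISPLAY of the Plugged §2 (9 named + hM): `C`, `T` GONE (constructed), `hA ↦ hAb`; NOTHING new
displayed ⇒ 5 NAMED {h, hAb; hLiu; h21; hirr} + hM and NO posited data at all (the de Rham bullet 4 `r_μ` is pin-2's REAL carrier `Def45.RMuForm` with `hR` a
theorem, consumed by the source display `…RestOnePluggedR`).  Every Liu CARRIER of the END display is now a TREE TERM: 𝕍/𝔾 (honestP5Of), `iso`
(isoOf), {X_K, A_K, transfers} (sec42DataOf), μ (muOfInvType), 𝒜(μ) one-object rest with REAL A_μ / λ_μ (restOne, PolDR), ε/χ/ω(μ,ε,χ) (Def411WeilCarriers at the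
χ_μ-attached splitting sMu), Ω(μ)/res (restOne), the Hecke action (rhoΩOne of the constructed translates).  What the display still ASSUMES: the published theorems
`h` [Deligne1979 2.1.2/2.2.5], `hAb` [Liu2021 §2.1 + FGA], `h21` [Shimura1998 Thm. 21.4], `hLiu` [Liu2021 Thm. 4.18 — for the χ_μ-oscillator at the CONSTRUCTED system,
objects and Hecke action; (W3) «= as printed under [HKS96 §1 (1.14)–(1.15)]», the GR91 uniqueness being a tree theorem (`Item6OmegaMuSplittingUnique`); (W1)
residual «+ l. 1982 (r_μ obvious)»], `hirr` [Liu2021 Def. 4.11 / Lem. D.1 (1)], and the B01-O meeting binder `hM`.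
Seat prover-pub-hodgecm-own-htheta-g5-0 (own-htheta gen 5, S2-CRUX owner and S2 co-owner; hcomp-lead's «S5: FILE» word l.7889 names «the consumer's re-cut by
application (own-htheta ∕ pin-3)»).  Theorems only: TWO theorems, each ONE APPLICATION of the Plugged §1 / §2; no definition, no instance, no named fact, no
`variable`; nothing landed is edited or restated (NEW path, FILE-ONCE).  FRAMING: HC_CM is NOT proved; S2 = B01-S is NOT inhabited — the display is CONDITIONAL on
published theorems entered as hypotheses and on hM; the socket `FaceThetaDataExists` stays uninhabited.
FILING (pin-3 gen 4, prover-pub-hodgecm2-pin-3-g4-0 = FILER OF RECORD of the C∕T-plug re-cut per lead gen 9 HOME/INBOX l.7973 ∕ l.8047 and own-htheta g5 l.8020; ORDER RULE branch 2: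
pin-2's PLUGGED-R landed FIRST, so the C∕T plug RE-BASES on it — terminal «BUILT-R»): the bytes from the first `import` to EOF are own-htheta g5's draft
`g5/lean/Item6SupplyPinnedAssemblyAlongHoldsRestOneBuiltR.draft.lean` md5 ce43d3df3fcb VERBATIM (x2 g8 as-staged T1 l.8038, 134∕134 trio; X2BLTR identity).
-/
import Summits.HodgeConjecture.CorCM.B01.Transposition.Item6SupplyPinnedAssemblyAlongHoldsRestOnePluggedR
import Summits.HodgeConjecture.CorCM.B01.Transposition.HComp.Sec42DataOf
import Summits.HodgeConjecture.CorCM.B01.Transposition.HComp.HeckeTranslatesOfSec42DataOf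
import Literature.AlgebraicGeometry.ShimuraVarieties.UnitaryShimuraCanonicalModelHeckeHolds
import Literature.NumberTheory.Automorphic.Liu2021.AlbaneseBaseChangeProduct
import HarnessLib

set_option autoImplicit false

/-!
# B01-S and the (β)-free END display with EVERY Liu carrier CONSTRUCTED except the de Rham token (S5 × S6 on the plugged rest)

Instantiation of own-htheta's `…_restOne_plugged` (§1) / `…_restOne_plugged_meeting_rec` (§2), each BY ONE APPLICATION:
`C := Model.sec42DataOf h Model.isoOf`, `T := Model.heckeTranslatesFamilyOf heckeTranslate_definedOver_holds h Model.isoOf`,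
`hA := Liu2021.albanese_baseChange_isLimit_fan_jacobian_of_albanese_baseChange hAb`.  All displayed types agree after β/δ — no `rw`, no `▸`, no auxiliary `def`.
Kernel precedent: htheta-x2 g8's `X2PLG.plugged_end_CTU7_decited` (HOME/INBOX l.7833, 93∕93 trio on the staged bytes).  HC_CM is NOT proved.

References: Y. Liu, arXiv:2102.11518 = Camb. J. Math. 9 (2021): §2.1 Prop. 2.2, §4.2 l. 2053–2074, Def. 4.5 (2), Prop. 4.6 (1), Def. 4.11–4.12, Thm. 4.18 l. 2232–2245;
P. Deligne, *Variétés de Shimura* (1979) 2.1.2, 2.2.5; J. S. Milne, *Introduction to Shimura varieties* (2005) Thm. 13.6; G. Shimura (1998) Thm. 21.4; S. Gelbart,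
J. Rogawski (1991) §3.1 Prop. 3.1.1; M. Harris, S. Kudla, W. Sweet (1996) §1.
-/

noncomputable section

open scoped TensorProduct InnerProductSpace Kronecker

namespace Summit.HodgeConjecture.CorCM.Model

open CategoryTheory CategoryTheory.Limits AlgebraicGeometry NumberField
open Literature.AlgebraicGeometry.Motives
open Literature.AlgebraicGeometry.HodgeTheory
open Literature.AlgebraicGeometry.ShimuraVarieties
open Literature.AlgebraicGeometry.ShimuraVarieties.UnitaryCanonicalModel
open Literature.NumberTheory.ComplexMultiplication
open Literature.NumberTheory.Automorphic
open Literature.NumberTheory.Automorphic.IdeleClassGroup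
open Literature.NumberTheory.Automorphic.PicardCM
open Literature.NumberTheory.Automorphic.Liu2021
open Literature.NumberTheory.Automorphic.Liu2021.AppendixC
open Literature.NumberTheory.Automorphic.Liu2021.AppendixC.RestOne
open Literature.NumberTheory.Automorphic.Liu2021.Def411WeilCarriers (JW TW isSymm_TW isUnit_det_TW JW_eq)
open Literature.NumberTheory.GelbartRogawski1991 Literature.NumberTheory.GelbartRogawski1991.UnitaryDualPair
open Literature.NumberTheory.Weil1964 Literature.RepresentationTheory
open Summit.HodgeConjecture.CorCM.Transposition

/-! ## §1  B01-S at the built rest (C and T constructed) -/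

/-- **B01-S from [Liu2021, Thm. 4.18] with every carrier CONSTRUCTED except the de Rham token** (`U = picardCMUniverse hHD hI h₁ h₃`): own-htheta's
`faceSupply_of_thm418AsPrinted_along_conj_holds_restOne_plugged` at `C := sec42DataOf h isoOf`, `T := heckeTranslatesFamilyOf heckeTranslate_definedOver_holds h isoOf`,
`hA := albanese_baseChange_isLimit_fan_jacobian_of_albanese_baseChange hAb` — ONE APPLICATION.  Displayed: the cites `h` ([Deligne1979] 2.1.2/2.2.5), `hAb` ([Liu2021]
§2.1 + [FGA]), `h21` ([Shimura1998] Thm. 21.4), `hLiu` ([Liu2021] Thm. 4.18 at the constructed system/objects/action; (W3) «= as printed under [HKS96 (1.14)–(1.15)]»,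
(W1) «+ l. 1982»), the reading `hirr` (Def. 4.11 / Lem. D.1 (1)), and NO token.  NO `R`, `hR`, `C`, `T`, `iso`, `P`, `s`, `hs`, `hsc`, `hObj`, `hChi`, `hsm`,
`rhoΩ`, `hμ`, `i`, `hdim`, `hdet45`, `hA`, `hU7` binder.  HC_CM is NOT proved; none of the hypotheses is inhabited here.
[cite: Liu2021, Thm. 4.18 (FJcycle.tex l. 2232–2245), §4.2 l. 2053–2074, §2.1 Prop. 2.2, Prop. 4.6 (1), Def. 4.5 (2)] [cite: Milne2005ShimuraVarieties, Thm. 13.6 p. 118]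
[cite: Shimura1998, §21.4 Thm. 21.4] [cite: Deligne1979ShimuraVarieties, §2.1.2 and 2.2.5] -/
theorem faceSupply_of_thm418AsPrinted_along_conj_holds_restOne_builtR
    (hHD : exists_isReal_hodgeModel) (hI : hodgePQ_independent_of_hodgeModel)
    (h₁ : BallQuotientUniformised) (h₃ : CMAbelianVarietyRealised)
    (h : exists_recordSystem) (hAb : albanese_baseChange)
    (hLiu : ∀ (F : CMField) [IsGalois ℚ F] (h6 : 6 ≤ Module.finrank ℚ F) (Φ : CMType F) (ι₁ : F →+* ℂ), ι₁ ∈ Φ.1 →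
      ∀ V : HermSpace3 F ι₁, Thm418AsPrintedC (sec42DataOf h isoOf F ι₁ V Φ)
        (restOne (sec42DataOf h isoOf F ι₁ V Φ) (AlgHom.id ℚ F) ι₁ (isConjugateSymplectic_muOfInvType ι₁ Φ) (hasWeight_one_muOfInvType ι₁ Φ) (Def45.Carriers.ofPolDR (muOfInvType ι₁ Φ) (Def45.PolDR ι₁ (isConjugateSymplectic_muOfInvType ι₁ Φ) (Def45.RMuForm ι₁ (isConjugateSymplectic_muOfInvType ι₁ Φ))))
            (Def411WeilCarriers.Eps ↥(maximalRealSubfield F) (imagUnitSq F)) (Def411WeilCarriers.epsOf ↥(maximalRealSubfield F) (imagUnitSq F) F (imagUnit F)) (Def411WeilCarriers.Chi ↥(maximalRealSubfield F) F (IsCMField.complexConj F))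
            (Def411WeilCarriers.omega ↥(maximalRealSubfield F) F (IsCMField.complexConj F) 3 finProdFinEquiv (Matrix.diagonal V.diagEntries) (complexConj_imagUnit F) (imagUnit_ne_zero F) (imagUnit_mul_self F) (realDiagonal_isSymm F V.diagEntries V.complexConj_diagEntries) (isUnit_det_realDiagonal F V.diagEntries V.complexConj_diagEntries V.diagEntries_ne_zero) (realDiagonal_map F V.diagEntries V.complexConj_diagEntries).symm (OmegaMuSplitting.hsMu F ι₁ V Φ))
            (Def411WeilCarriers.rho ↥(maximalRealSubfield F) F (IsCMField.complexConj F) 3 finProdFinEquiv (Matrix.diagonal V.diagEntries) (complexConj_imagUnit F) (imagUnit_ne_zero F) (imagUnit_mul_self F) (realDiagonal_isSymm F V.diagEntries V.complexConj_diagEntries) (isUnit_det_realDiagonal F V.diagEntries V.complexConj_diagEntries V.diagEntries_ne_zero) (realDiagonal_map F V.diagEntries V.complexConj_diagEntries).symm (OmegaMuSplitting.hsMu F ι₁ V Φ) V.adelicFinDiag.toMulEquiv.toMonoidHom) ((heckeTranslatesFamilyOf heckeTranslate_definedOver_holds h isoOf F ι₁ V Φ h6).rhoΩOne (AlgHom.id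 ℚ F) ι₁ (isConjugateSymplectic_muOfInvType ι₁ Φ) (hasWeight_one_muOfInvType ι₁ Φ) (Def45.Carriers.ofPolDR (muOfInvType ι₁ Φ) (Def45.PolDR ι₁ (isConjugateSymplectic_muOfInvType ι₁ Φ) (Def45.RMuForm ι₁ (isConjugateSymplectic_muOfInvType ι₁ Φ)))))))
    (h21 : shimura1998_thm21_4_casselman)
    (hirr : ∀ (F : CMField) [IsGalois ℚ F] (h6 : 6 ≤ Module.finrank ℚ F) (Φ : CMType F) (ι₁ : F →+* ℂ), ι₁ ∈ Φ.1 →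
      ∀ (V : HermSpace3 F ι₁)
        (i : (toThm418Data (sec42DataOf h isoOf F ι₁ V Φ)
          (restOne (sec42DataOf h isoOf F ι₁ V Φ) (AlgHom.id ℚ F) ι₁ (isConjugateSymplectic_muOfInvType ι₁ Φ) (hasWeight_one_muOfInvType ι₁ Φ) (Def45.Carriers.ofPolDR (muOfInvType ι₁ Φ) (Def45.PolDR ι₁ (isConjugateSymplectic_muOfInvType ι₁ Φ) (Def45.RMuForm ι₁ (isConjugateSymplectic_muOfInvType ι₁ Φ))))
            (Def411WeilCarriers.Eps ↥(maximalRealSubfield F) (imagUnitSq F)) (Def411WeilCarriers.epsOf ↥(maximalRealSubfield F) (imagUnitSq F) F (imagUnit F)) (Def411WeilCarriers.Chi ↥(maximalRealSubfield F) F (IsCMField.complexConj F))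
            (Def411WeilCarriers.omega ↥(maximalRealSubfield F) F (IsCMField.complexConj F) 3 finProdFinEquiv (Matrix.diagonal V.diagEntries) (complexConj_imagUnit F) (imagUnit_ne_zero F) (imagUnit_mul_self F) (realDiagonal_isSymm F V.diagEntries V.complexConj_diagEntries) (isUnit_det_realDiagonal F V.diagEntries V.complexConj_diagEntries V.diagEntries_ne_zero) (realDiagonal_map F V.diagEntries V.complexConj_diagEntries).symm (OmegaMuSplitting.hsMu F ι₁ V Φ))
            (Def411WeilCarriers.rho ↥(maximalRealSubfield F) F (IsCMField.complexConj F) 3 finProdFinEquiv (Matrix.diagonal V.diagEntries) (complexConj_imagUnit F) (imagUnit_ne_zero F) (imagUnit_mul_self F) (realDiagonal_isSymm F V.diagEntries V.complexConj_diagEntries) (isUnit_det_realDiagonal F V.diagEntries V.complexConj_diagEntries V.diagEntries_ne_zero) (realDiagonal_map F V.diagEntries V.complexConj_diagEntries).symm (OmegaMuSplitting.hsMu F ι₁ V Φ) V.adelicFinDiag.toMulEquiv.toMonoidHom) ((heckeTranslatesFamilyOf heckeTranslate_definedOver_holds h isoOf F ι₁ V Φ h6).rhoΩOne (AlgHom.id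 ℚ F) ι₁ (isConjugateSymplectic_muOfInvType ι₁ Φ) (hasWeight_one_muOfInvType ι₁ Φ) (Def45.Carriers.ofPolDR (muOfInvType ι₁ Φ) (Def45.PolDR ι₁ (isConjugateSymplectic_muOfInvType ι₁ Φ) (Def45.RMuForm ι₁ (isConjugateSymplectic_muOfInvType ι₁ Φ))))))).AdmIndex),
        (Def411WeilCarriers.rho ↥(maximalRealSubfield F) F (IsCMField.complexConj F) 3 finProdFinEquiv (Matrix.diagonal V.diagEntries) (complexConj_imagUnit F) (imagUnit_ne_zero F) (imagUnit_mul_self F) (realDiagonal_isSymm F V.diagEntries V.complexConj_diagEntries) (isUnit_det_realDiagonal F V.diagEntries V.complexConj_diagEntries V.diagEntries_ne_zero) (realDiagonal_map F V.diagEntries V.complexConj_diagEntries).symm (OmegaMuSplitting.hsMu F ι₁ V Φ) V.adelicFinDiag.toMulEquiv.toMonoidHom i.1.1 i.1.2).IsIrreducible) :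
    (picardCMUniverse hHD hI h₁ h₃).FaceSupply :=
  faceSupply_of_thm418AsPrinted_along_conj_holds_restOne_pluggedR hHD hI h₁ h₃ h
    (Liu2021.albanese_baseChange_isLimit_fan_jacobian_of_albanese_baseChange hAb)
    (sec42DataOf h isoOf) (heckeTranslatesFamilyOf heckeTranslate_definedOver_holds h isoOf) hLiu h21 hirr


/-! ## §2  THE (β)-FREE END DISPLAY, MEETING FORM, on the universe of record, at the built rest -/

section MeetingFormBuilt

open MeasureTheory
open Prior.Perl34File (Perl34.IsolationSetting)
open Prior.Perl34File.Perl34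

/-- **END DISPLAY, (β)-FREE MEETING FORM, on the universe OF RECORD, with every Liu carrier CONSTRUCTED except the de Rham token** (`let U := U_rec`): own-htheta's
`hc_cm_of_thm418AsPrinted_along_conj_holds_restOne_plugged_meeting_rec` at `C := sec42DataOf h isoOf`, `T := heckeTranslatesFamilyOf heckeTranslate_definedOver_holds h isoOf`,
`hA := …_of_albanese_baseChange hAb` — ONE APPLICATION.  Displayed hypotheses = cites {`h`, `hAb`, `h21`, `hLiu`} · reading {`hirr`} · NO data + the theta-side
meeting binder `hM` (b01-x2's text VERBATIM at `U_rec`) = 5 NAMED + hM.  HC_CM is NOT proved: no hypothesis is inhabited here.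
[cite: Liu2021, Thm. 4.18 (FJcycle.tex l. 2232–2245), §2.1 Prop. 2.2, Prop. 4.6 (1), Def. 4.5 (2)] [cite: Milne2005ShimuraVarieties, Thm. 13.6 p. 118]
[cite: Shimura1998, §21.4 Thm. 21.4] [cite: Deligne1979ShimuraVarieties, §2.1.2 and 2.2.5] -/
theorem hc_cm_of_thm418AsPrinted_along_conj_holds_restOne_builtR_meeting_rec
    (h : exists_recordSystem) (hAb : albanese_baseChange)
    (hLiu : ∀ (F : CMField) [IsGalois ℚ F] (h6 : 6 ≤ Module.finrank ℚ F) (Φ : CMType F) (ι₁ : F →+* ℂ), ι₁ ∈ Φ.1 →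
      ∀ V : HermSpace3 F ι₁, Thm418AsPrintedC (sec42DataOf h isoOf F ι₁ V Φ)
        (restOne (sec42DataOf h isoOf F ι₁ V Φ) (AlgHom.id ℚ F) ι₁ (isConjugateSymplectic_muOfInvType ι₁ Φ) (hasWeight_one_muOfInvType ι₁ Φ) (Def45.Carriers.ofPolDR (muOfInvType ι₁ Φ) (Def45.PolDR ι₁ (isConjugateSymplectic_muOfInvType ι₁ Φ) (Def45.RMuForm ι₁ (isConjugateSymplectic_muOfInvType ι₁ Φ))))
            (Def411WeilCarriers.Eps ↥(maximalRealSubfield F) (imagUnitSq F)) (Def411WeilCarriers.epsOf ↥(maximalRealSubfield F) (imagUnitSq F) F (imagUnit F)) (Def411WeilCarriers.Chi ↥(maximalRealSubfield F) F (IsCMField.complexConj F))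
            (Def411WeilCarriers.omega ↥(maximalRealSubfield F) F (IsCMField.complexConj F) 3 finProdFinEquiv (Matrix.diagonal V.diagEntries) (complexConj_imagUnit F) (imagUnit_ne_zero F) (imagUnit_mul_self F) (realDiagonal_isSymm F V.diagEntries V.complexConj_diagEntries) (isUnit_det_realDiagonal F V.diagEntries V.complexConj_diagEntries V.diagEntries_ne_zero) (realDiagonal_map F V.diagEntries V.complexConj_diagEntries).symm (OmegaMuSplitting.hsMu F ι₁ V Φ))
            (Def411WeilCarriers.rho ↥(maximalRealSubfield F) F (IsCMField.complexConj F) 3 finProdFinEquiv (Matrix.diagonal V.diagEntries) (complexConj_imagUnit F) (imagUnit_ne_zero F) (imagUnit_mul_self F) (realDiagonal_isSymm F V.diagEntries V.complexConj_diagEntries) (isUnit_det_realDiagonal F V.diagEntries V.complexConj_diagEntries V.diagEntries_ne_zero) (realDiagonal_map F V.diagEntries V.complexConj_diagEntries).symm (OmegaMuSplitting.hsMu F ι₁ V Φ) V.adelicFinDiag.toMulEquiv.toMonoidHom) ((heckeTranslatesFamilyOf heckeTranslate_definedOver_holds h isoOf F ι₁ V Φ h6).rhoΩOne (AlgHom.id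 ℚ F) ι₁ (isConjugateSymplectic_muOfInvType ι₁ Φ) (hasWeight_one_muOfInvType ι₁ Φ) (Def45.Carriers.ofPolDR (muOfInvType ι₁ Φ) (Def45.PolDR ι₁ (isConjugateSymplectic_muOfInvType ι₁ Φ) (Def45.RMuForm ι₁ (isConjugateSymplectic_muOfInvType ι₁ Φ)))))))
    (h21 : shimura1998_thm21_4_casselman)
    (hirr : ∀ (F : CMField) [IsGalois ℚ F] (h6 : 6 ≤ Module.finrank ℚ F) (Φ : CMType F) (ι₁ : F →+* ℂ), ι₁ ∈ Φ.1 →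
      ∀ (V : HermSpace3 F ι₁)
        (i : (toThm418Data (sec42DataOf h isoOf F ι₁ V Φ)
          (restOne (sec42DataOf h isoOf F ι₁ V Φ) (AlgHom.id ℚ F) ι₁ (isConjugateSymplectic_muOfInvType ι₁ Φ) (hasWeight_one_muOfInvType ι₁ Φ) (Def45.Carriers.ofPolDR (muOfInvType ι₁ Φ) (Def45.PolDR ι₁ (isConjugateSymplectic_muOfInvType ι₁ Φ) (Def45.RMuForm ι₁ (isConjugateSymplectic_muOfInvType ι₁ Φ))))
            (Def411WeilCarriers.Eps ↥(maximalRealSubfield F) (imagUnitSq F)) (Def411WeilCarriers.epsOf ↥(maximalRealSubfield F) (imagUnitSq F) F (imagUnit F)) (Def411WeilCarriers.Chi ↥(maximalRealSubfield F) F (IsCMField.complexConj F))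
            (Def411WeilCarriers.omega ↥(maximalRealSubfield F) F (IsCMField.complexConj F) 3 finProdFinEquiv (Matrix.diagonal V.diagEntries) (complexConj_imagUnit F) (imagUnit_ne_zero F) (imagUnit_mul_self F) (realDiagonal_isSymm F V.diagEntries V.complexConj_diagEntries) (isUnit_det_realDiagonal F V.diagEntries V.complexConj_diagEntries V.diagEntries_ne_zero) (realDiagonal_map F V.diagEntries V.complexConj_diagEntries).symm (OmegaMuSplitting.hsMu F ι₁ V Φ))
            (Def411WeilCarriers.rho ↥(maximalRealSubfield F) F (IsCMField.complexConj F) 3 finProdFinEquiv (Matrix.diagonal V.diagEntries) (complexConj_imagUnit F) (imagUnit_ne_zero F) (imagUnit_mul_self F) (realDiagonal_isSymm F V.diagEntries V.complexConj_diagEntries) (isUnit_det_realDiagonal F V.diagEntries V.complexConj_diagEntries V.diagEntries_ne_zero) (realDiagonal_map F V.diagEntries V.complexConj_diagEntries).symm (OmegaMuSplitting.hsMu F ι₁ V Φ) V.adelicFinDiag.toMulEquiv.toMonoidHom) ((heckeTranslatesFamilyOf heckeTranslate_definedOver_holds h isoOf F ι₁ V Φ h6).rhoΩOne (AlgHom.id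 ℚ F) ι₁ (isConjugateSymplectic_muOfInvType ι₁ Φ) (hasWeight_one_muOfInvType ι₁ Φ) (Def45.Carriers.ofPolDR (muOfInvType ι₁ Φ) (Def45.PolDR ι₁ (isConjugateSymplectic_muOfInvType ι₁ Φ) (Def45.RMuForm ι₁ (isConjugateSymplectic_muOfInvType ι₁ Φ))))))).AdmIndex),
        (Def411WeilCarriers.rho ↥(maximalRealSubfield F) F (IsCMField.complexConj F) 3 finProdFinEquiv (Matrix.diagonal V.diagEntries) (complexConj_imagUnit F) (imagUnit_ne_zero F) (imagUnit_mul_self F) (realDiagonal_isSymm F V.diagEntries V.complexConj_diagEntries) (isUnit_det_realDiagonal F V.diagEntries V.complexConj_diagEntries V.diagEntries_ne_zero) (realDiagonal_map F V.diagEntries V.complexConj_diagEntries).symm (OmegaMuSplitting.hsMu F ι₁ V Φ) V.adelicFinDiag.toMulEquiv.toMonoidHom i.1.1 i.1.2).IsIrreducible) :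
    let U := picardCMUniverse exists_isReal_hodgeModel_holds hodgePQ_independent_of_hodgeModel_holds
      BallQuotient.ballQuotientUniformised_holds cmAbelianVarietyRealised_holds
    let hU := ballQuotientUniformisedDatum_of BallQuotient.ballQuotientUniformised_holds
    (∀ (F : CMField), IsGalois ℚ F → 6 ≤ Module.finrank ℚ F → ∀ (f : Face F) (ι₁ : F →+* ℂ), f.Admissible ι₁ →
      ∀ V : HermSpace3 F ι₁,
      ∃ (H CG G SK SigIdx SigIdxG : Type) (_ : NormedAddCommGroup H) (_ : InnerProductSpace ℂ H) (_ : CompleteSpace H)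
        (_ : NormedAddCommGroup CG) (_ : NormedSpace ℂ CG) (_ : Group G) (_ : TopologicalSpace G) (_ : TopologicalSpace SK)
        (S : Perl34.IsolationSetting H (Lp ℂ 2 V.autMeasure) CG G SK SigIdx SigIdxG),
        (∀ (Γ : Level V) (ω₁ ω₂ : U.CohC (U.pms F ι₁ V Γ) 1),
          ω₁ ∈ U.Uiso Γ F (f.psi 0) ι₁ → ω₂ ∈ U.Uiso Γ F (f.psi 1) ι₁ →
            embOf exists_isReal_hodgeModel_holds hodgePQ_independent_of_hodgeModel_holds hU cmAbelianVarietyRealised_holds Γ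
                (U.cup2C (U.pms F ι₁ V Γ) 1 ω₁ ω₂) ≠ 0 →
              ∃ u ∈ S.t12.S12,
                ⟪embOf exists_isReal_hodgeModel_holds hodgePQ_independent_of_hodgeModel_holds hU cmAbelianVarietyRealised_holds Γ
                    (U.cup2C (U.pms F ι₁ V Γ) 1 ω₁ ω₂), u⟫_ℂ ≠ 0) ∧
        (∀ χ : S.t34.X, S.t34.allowed χ → ∀ (Φ : SK) (Γ₁ : Level V)
          (ω₁ ω₂ : U.CohC (U.pms F ι₁ V Γ₁) 1),
          ω₁ ∈ U.Uiso Γ₁ F (f.psi 0) ι₁ →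
          ω₂ ∈ U.Uiso Γ₁ F (f.psi 1) ι₁ →
            ⟪embOf exists_isReal_hodgeModel_holds hodgePQ_independent_of_hodgeModel_holds hU cmAbelianVarietyRealised_holds Γ₁
                (U.cup2C (U.pms F ι₁ V Γ₁) 1 ω₁ ω₂),
              S.t34.ϑ χ Φ⟫_ℂ ≠ 0 →
              ∃ (Γ : Level V) (ω : Fin 4 → U.CohC (U.pms F ι₁ V Γ) 1),
                (∀ i, ω i ∈ U.Uiso Γ F (f.psi i) ι₁) ∧
                  ⟪embOf exists_isReal_hodgeModel_holds hodgePQ_independent_of_hodgeModel_holds hU cmAbelianVarietyRealised_holds Γ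
                      (U.cup2C (U.pms F ι₁ V Γ) 1 (ω 2) (ω 3)),
                    embOf exists_isReal_hodgeModel_holds hodgePQ_independent_of_hodgeModel_holds hU cmAbelianVarietyRealised_holds Γ
                      (U.cup2C (U.pms F ι₁ V Γ) 1 (ω 0) (ω 1))⟫_ℂ
                    ≠ 0)) →
    HC_CM :=
  hc_cm_of_thm418AsPrinted_along_conj_holds_restOne_pluggedR_meeting_rec h
    (Liu2021.albanese_baseChange_isLimit_fan_jacobian_of_albanese_baseChange hAb)
    (sec42DataOf h isoOf) (heckeTranslatesFamilyOf heckeTranslate_definedOver_holds h isoOf) hLiu h21 hirr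

end MeetingFormBuilt

end Summit.HodgeConjecture.CorCM.Model

end
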